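import Literature.Analysis.FluidPDE.AlexakisDoeringInterpolation
import Literature.Analysis.FluidPDE.TimeAverageEnstrophy
import HarnessLib

/-!
# Long-time `limsup` averages are invariant under time translation

Analysis/FluidPDE support file (all proved) for the long-time averages of `TurbWave0`
(`timeMean g T = T⁻¹∫₀ᵀ g`, `longTimeAvgSup g = limsup_{T→∞} timeMean g T`; Doering–Foias 2002,
§2; Frisch 1995, Ch. 5). For a nonnegative locally integrable `φ` on `[0, ∞)` and `s ≥ 0`,
`⟨φ(· + s)⟩ = ⟨φ⟩` (`longTimeAvgSup_comp_add_right`): the running means satisfy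
`T⁻¹∫₀ᵀ φ(t + s) dt = ((T+s)/T) · (T+s)⁻¹∫₀^{T+s} φ - T⁻¹∫₀ˢ φ` (`timeMean_comp_add_right`), so
they are eventually bounded above simultaneously (`isBoundedUnder_timeMean_comp_add_right_iff`)
and, when bounded, differ from the shifted means `T ↦ (T+s)⁻¹∫₀^{T+s} φ` by `o(1)`; when
unbounded both `limsup`s are Mathlib's junk value `sInf ∅ = 0`. Consequences for global
Leray–Hopf solutions on `T^d` (`Torus.IsGlobalLerayHopf`): the mean energy
`⟨‖u‖₂²⟩ = meanEnergy u` and the mean dissipation `⟨ν‖∇u‖₂²⟩ = meanDissipation ν u`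
(`ZerothLaw`) of the translate `u(· + s)` equal those of `u`
(`IsGlobalLerayHopf.meanEnergy_translate`, `IsGlobalLerayHopf.meanDissipation_translate`) — the
folklore remark that long-time averages do not see a finite initial layer, used when a
Leray–Hopf solution is restarted at a positive time (e.g. to gain an `H¹` datum in two
dimensions; Foias–Manley–Rosa–Temam 2001, Ch. II (7.16)–(7.17)).

## References

* C. R. Doering, C. Foias, *Energy dissipation in body-forced turbulence*, J. Fluid Mech. 467
  (2002), §2. [DoeringFoias2002]
* U. Frisch, *Turbulence* (CUP 1995), Ch. 5. [Frisch1995]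
-/

noncomputable section

open MeasureTheory Set Filter Topology
open scoped ENNReal NNReal

namespace Literature.Analysis.FluidPDE

/-! ### Real-variable core -/

section Real

variable {φ : ℝ → ℝ} {s : ℝ}

/-- **Running means of a translate**: for `T > 0`, `s ≥ 0` and `φ` interval integrable on
`[0, s]` and `[s, T + s]`,
`T⁻¹∫₀ᵀ φ(t + s) dt = ((T + s)/T) · timeMean φ (T + s) - T⁻¹ ∫₀ˢ φ`
(`∫₀ᵀ φ(· + s) = ∫ₛ^{T+s} φ = ∫₀^{T+s} φ - ∫₀ˢ φ`). [folklore] -/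
theorem timeMean_comp_add_right (hs : 0 ≤ s) {T : ℝ} (hT : 0 < T)
    (h₁ : IntervalIntegrable φ volume 0 s) (h₂ : IntervalIntegrable φ volume s (T + s)) :
    timeMean (fun t => φ (t + s)) T =
      (T + s) / T * timeMean φ (T + s) - T⁻¹ * ∫ t in (0 : ℝ)..s, φ t := by
  have hTs : T + s ≠ 0 := by positivity
  unfold timeMean
  rw [intervalIntegral.integral_comp_add_right φ s, zero_add,
    ← intervalIntegral.integral_add_adjacent_intervals h₁ h₂]
  field_simp
  ring

/-- `limsup` along `atTop` does not see a translation of the argument: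
`limsup_{T→∞} A(T + s) = limsup_{T→∞} A(T)` (the translation is an order isomorphism of `ℝ`,
so it maps `atTop` onto `atTop`). [folklore] -/
theorem limsup_comp_add_right_atTop (A : ℝ → ℝ) (s : ℝ) :
    limsup (fun T => A (T + s)) atTop = limsup A atTop := by
  have hmap : map (fun T : ℝ => T + s) atTop = atTop := (OrderIso.addRight s).map_atTop
  conv_rhs => rw [← hmap]
  simp only [limsup_eq, eventually_map]

/-- Eventual boundedness from above along `atTop` does not see a translation of the
argument. [folklore] -/
theorem isBoundedUnder_comp_add_right_atTop_iff (A : ℝ → ℝ) (s : ℝ) :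
    IsBoundedUnder (· ≤ ·) atTop (fun T => A (T + s)) ↔ IsBoundedUnder (· ≤ ·) atTop A := by
  have hmap : map (fun T : ℝ => T + s) atTop = atTop := (OrderIso.addRight s).map_atTop
  constructor
  · rintro ⟨b, hb⟩
    refine ⟨b, ?_⟩
    rw [eventually_map] at hb ⊢
    rw [← hmap, eventually_map]
    exact hb
  · rintro ⟨b, hb⟩
    refine ⟨b, ?_⟩
    rw [eventually_map] at hb ⊢
    have : ∀ᶠ T in map (fun T : ℝ => T + s) atTop, A T ≤ b := by rwa [hmap]
    rwa [eventually_map] at this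

/-- An unbounded real family has junk `limsup = sInf ∅ = 0` — this is Mathlib's
`Real.limsup_of_not_isBoundedUnder` (`Mathlib/Order/Filter/ENNReal.lean`); kept as a deprecated
alias (librarian dedup-01475). [folklore] -/
@[deprecated Real.limsup_of_not_isBoundedUnder (since := "2026-08-16")]
alias limsup_eq_zero_of_not_isBoundedUnder := Real.limsup_of_not_isBoundedUnder

/-- **The running means of `φ` and of `φ(· + s)` are eventually bounded above
simultaneously** (`φ ≥ 0` locally integrable on `[0, ∞)`, `s ≥ 0`): by
`timeMean_comp_add_right`, `timeMean (φ(·+s)) T ≤ (1 + s) timeMean φ (T+s)` and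
`timeMean φ (T+s) ≤ timeMean (φ(·+s)) T + ∫₀ˢφ` for `T ≥ 1`. [folklore] -/
theorem isBoundedUnder_timeMean_comp_add_right_iff (hφ : ∀ t, 0 ≤ φ t) (hs : 0 ≤ s)
    (hint : ∀ a b, 0 ≤ a → a ≤ b → IntervalIntegrable φ volume a b) :
    IsBoundedUnder (· ≤ ·) atTop (timeMean fun t => φ (t + s)) ↔
      IsBoundedUnder (· ≤ ·) atTop (timeMean φ) := by
  set I : ℝ := ∫ t in (0 : ℝ)..s, φ t with hI
  have hI0 : 0 ≤ I := intervalIntegral.integral_nonneg hs fun t _ => hφ t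
  have hid : ∀ T, 0 < T → timeMean (fun t => φ (t + s)) T =
      (T + s) / T * timeMean φ (T + s) - T⁻¹ * I := fun T hT =>
    timeMean_comp_add_right hs hT (hint 0 s le_rfl hs) (hint s (T + s) hs (by linarith))
  have hA0 : ∀ T, 0 ≤ T → 0 ≤ timeMean φ T := fun T hT => timeMean_nonneg hφ hT
  have hB0 : ∀ T, 0 ≤ T → 0 ≤ timeMean (fun t => φ (t + s)) T := fun T hT =>
    timeMean_nonneg (fun t => hφ (t + s)) hT
  constructor
  · rintro ⟨b, hb⟩
    rw [eventually_map] at hb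
    -- `timeMean φ (T + s) ≤ timeMean (φ(·+s)) T + I` for `T ≥ 1`
    rw [← isBoundedUnder_comp_add_right_atTop_iff _ s]
    refine ⟨b + I, ?_⟩
    rw [eventually_map]
    filter_upwards [hb, eventually_ge_atTop (1 : ℝ)] with T hbT hT1
    have hT : 0 < T := by linarith
    have h1 := hid T hT
    have hA := hA0 (T + s) (by linarith)
    have h2 : timeMean φ (T + s) ≤ (T + s) / T * timeMean φ (T + s) := by
      have h3 : 1 ≤ (T + s) / T := by
        rw [le_div_iff₀ hT]
        linarith
      exact le_mul_of_one_le_left hA h3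
    have h4 : T⁻¹ * I ≤ I := by
      have : T⁻¹ ≤ 1 := inv_le_one_of_one_le₀ hT1
      exact (mul_le_mul_of_nonneg_right this hI0).trans_eq (one_mul I)
    show timeMean φ (T + s) ≤ b + I
    linarith
  · intro hA
    obtain ⟨c, hc⟩ := (isBoundedUnder_comp_add_right_atTop_iff (timeMean φ) s).2 hA
    rw [eventually_map] at hc
    refine ⟨(1 + s) * max c 0, ?_⟩
    rw [eventually_map]
    filter_upwards [hc, eventually_ge_atTop (1 : ℝ)] with T hcT hT1
    have hT : 0 < T := by linarith
    rw [hid T hT]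
    have hA' := hA0 (T + s) (by linarith)
    have h1 : (T + s) / T ≤ 1 + s := by
      rw [div_le_iff₀ hT]
      nlinarith
    have h2 : (T + s) / T * timeMean φ (T + s) ≤ (1 + s) * max c 0 :=
      mul_le_mul h1 ((show timeMean φ (T + s) ≤ c from hcT).trans (le_max_left _ _)) hA'
        (by linarith)
    have h3 : 0 ≤ T⁻¹ * I := mul_nonneg (inv_nonneg.2 hT.le) hI0
    linarith

/-- **Long-time `limsup` averages are translation invariant.** For `φ ≥ 0` locally integrable
and `s ≥ 0`, `longTimeAvgSup (φ(· + s)) = longTimeAvgSup φ`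
(`⟨g⟩ = limsup_{T→∞} T⁻¹∫₀ᵀ g`, Doering–Foias 2002, §2): if the running means are eventually
bounded, `timeMean (φ(·+s)) T - timeMean φ (T + s) = (s/T) timeMean φ (T+s) - T⁻¹∫₀ˢφ → 0`
and `limsup` does not see the translation `T ↦ T + s`; otherwise both sides are the junk
value `0` (`isBoundedUnder_timeMean_comp_add_right_iff`). [folklore] -/
theorem longTimeAvgSup_comp_add_right (hφ : ∀ t, 0 ≤ φ t) (hs : 0 ≤ s)
    (hint : ∀ a b, 0 ≤ a → a ≤ b → IntervalIntegrable φ volume a b) :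
    longTimeAvgSup (fun t => φ (t + s)) = longTimeAvgSup φ := by
  set I : ℝ := ∫ t in (0 : ℝ)..s, φ t with hI
  set A : ℝ → ℝ := timeMean φ with hA
  set B : ℝ → ℝ := timeMean fun t => φ (t + s) with hB
  have hI0 : 0 ≤ I := intervalIntegral.integral_nonneg hs fun t _ => hφ t
  have hid : ∀ T, 0 < T → B T = (T + s) / T * A (T + s) - T⁻¹ * I := fun T hT =>
    timeMean_comp_add_right hs hT (hint 0 s le_rfl hs) (hint s (T + s) hs (by linarith))
  have hA0 : ∀ T, 0 ≤ T → 0 ≤ A T := fun T hT => timeMean_nonneg hφ hT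
  have hB0 : ∀ T, 0 ≤ T → 0 ≤ B T := fun T hT => timeMean_nonneg (fun t => hφ (t + s)) hT
  unfold longTimeAvgSup
  by_cases hbdd : IsBoundedUnder (· ≤ ·) atTop A
  · -- bounded case: `B T - A (T + s) → 0`
    obtain ⟨c, hc⟩ := (isBoundedUnder_comp_add_right_atTop_iff A s).2 hbdd
    rw [eventually_map] at hc
    have hdiff : Tendsto (fun T => B T - A (T + s)) atTop (𝓝 0) := by
      have hup : Tendsto (fun T : ℝ => (s * max c 0 + I) * T⁻¹) atTop (𝓝 0) := by
        simpa using tendsto_inv_atTop_zero.const_mul (s * max c 0 + I)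
      refine squeeze_zero_norm' ?_ hup
      filter_upwards [hc, eventually_ge_atTop (1 : ℝ)] with T hcT hT1
      have hT : 0 < T := by linarith
      have hAT := hA0 (T + s) (by linarith)
      have hcT' : A (T + s) ≤ max c 0 := (show A (T + s) ≤ c from hcT).trans (le_max_left _ _)
      rw [hid T hT, Real.norm_eq_abs, abs_le]
      have h1 : (T + s) / T * A (T + s) - T⁻¹ * I - A (T + s) = T⁻¹ * (s * A (T + s) - I) := by
        field_simp
        ring
      rw [h1]
      have hTi : 0 ≤ T⁻¹ := inv_nonneg.2 hT.le
      constructor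
      · have : -(s * max c 0 + I) ≤ s * A (T + s) - I := by nlinarith
        nlinarith [mul_le_mul_of_nonneg_left this hTi]
      · have : s * A (T + s) - I ≤ s * max c 0 + I := by nlinarith
        nlinarith [mul_le_mul_of_nonneg_left this hTi]
    -- boundedness data for `limsup` algebra
    have hbddS : IsBoundedUnder (· ≤ ·) atTop (fun T => A (T + s)) := ⟨c, by rwa [eventually_map]⟩
    have hcoS : IsCoboundedUnder (· ≤ ·) atTop (fun T => A (T + s)) :=
      isCoboundedUnder_le_of_eventually_le atTop (x := 0) (by
        filter_upwards [eventually_ge_atTop (0 : ℝ)] with T hT using hA0 (T + s) (by linarith))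
    have hbddB : IsBoundedUnder (· ≤ ·) atTop B :=
      (isBoundedUnder_timeMean_comp_add_right_iff hφ hs hint).2 hbdd
    have hcoB : IsCoboundedUnder (· ≤ ·) atTop B :=
      isCoboundedUnder_le_of_eventually_le atTop (x := 0) (by
        filter_upwards [eventually_ge_atTop (0 : ℝ)] with T hT using hB0 T hT)
    rw [← limsup_comp_add_right_atTop A s]
    have hev : ∀ ε : ℝ, 0 < ε → (∀ᶠ T in atTop, B T ≤ A (T + s) + ε) ∧
        ∀ᶠ T in atTop, A (T + s) ≤ B T + ε := by
      intro ε hε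
      have h := (Metric.tendsto_nhds.1 hdiff) ε hε
      constructor
      · filter_upwards [h] with T hT
        rw [Real.dist_eq, sub_zero, abs_lt] at hT
        linarith [hT.2]
      · filter_upwards [h] with T hT
        rw [Real.dist_eq, sub_zero, abs_lt] at hT
        linarith [hT.1]
    refine le_antisymm (le_of_forall_pos_le_add fun ε hε => ?_) (le_of_forall_pos_le_add fun ε hε => ?_)
    · calc limsup B atTop ≤ limsup (fun T => A (T + s) + ε) atTop :=
            limsup_le_limsup (hev ε hε).1 hcoB (isBoundedUnder_le_add hbddS isBoundedUnder_const)
        _ = limsup (fun T => A (T + s)) atTop + ε := limsup_add_const atTop _ ε hbddS hcoS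
    · calc limsup (fun T => A (T + s)) atTop ≤ limsup (fun T => B T + ε) atTop :=
            limsup_le_limsup (hev ε hε).2 hcoS (isBoundedUnder_le_add hbddB isBoundedUnder_const)
        _ = limsup B atTop + ε := limsup_add_const atTop _ ε hbddB hcoB
  · -- unbounded case: both `limsup`s are junk `0`
    have hB : ¬ IsBoundedUnder (· ≤ ·) atTop B := fun h =>
      hbdd ((isBoundedUnder_timeMean_comp_add_right_iff hφ hs hint).1 h)
    rw [Real.limsup_of_not_isBoundedUnder hB, Real.limsup_of_not_isBoundedUnder hbdd]

end Real

/-! ### Leray–Hopf solutions: mean energy and mean dissipation of a translate -/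

section LerayHopf

variable {d : Type*} [Fintype d] [DecidableEq d] {ν : ℝ}
  {f : ℝ → UnitAddTorus d → EuclideanSpace ℝ d} {u₀ : UnitAddTorus d → EuclideanSpace ℝ d}
  {u : ℝ → UnitAddTorus d → EuclideanSpace ℝ d}

/-- Interval integrability on `[a, b] ⊆ [0, ∞)` from integrability on every `(0, T]`. [folklore] -/
theorem intervalIntegrable_of_forall_integrableOn_Ioc {φ : ℝ → ℝ}
    (h : ∀ T, 0 < T → IntegrableOn φ (Ioc 0 T)) {a b : ℝ} (ha : 0 ≤ a) (hab : a ≤ b) :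
    IntervalIntegrable φ volume a b := by
  rcases hab.eq_or_lt with rfl | hlt
  · exact IntervalIntegrable.refl
  · rw [intervalIntegrable_iff_integrableOn_Ioc_of_le hab]
    exact (h b (ha.trans_lt hlt)).mono_set (Ioc_subset_Ioc_left ha)

/-- **The mean energy does not see a time translation**: for a global Leray–Hopf weak
solution `u` on `T^d` (any force) and `s ≥ 0`, `⟨‖u(· + s)‖₂²⟩ = ⟨‖u‖₂²⟩`, i.e.
`meanEnergy (u(· + s)) = meanEnergy u` (`longTimeAvgSup_comp_add_right` for the nonnegative,
locally integrable `t ↦ ‖u(t)‖₂²`). [folklore] -/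
theorem Torus.IsGlobalLerayHopf.meanEnergy_translate (hu : Torus.IsGlobalLerayHopf ν f u₀ u)
    {s : ℝ} (hs : 0 ≤ s) : meanEnergy (fun t => u (t + s)) = meanEnergy u := by
  rw [meanEnergy_eq_longTimeAvgSup, meanEnergy_eq_longTimeAvgSup]
  exact longTimeAvgSup_comp_add_right (φ := fun t => ∫ x, ‖u t x‖ ^ 2)
    (fun t => integral_nonneg fun _ => sq_nonneg _) hs
    (fun a b ha hab => intervalIntegrable_of_forall_integrableOn_Ioc
      (fun T hT => hu.integrableOn_integral_norm_sq hT) ha hab)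

/-- **The mean dissipation does not see a time translation**: for a global Leray–Hopf weak
solution `u` on `T^d` (any force), `ν ≥ 0` and `s ≥ 0`, `⟨ν‖∇u(· + s)‖₂²⟩ = ⟨ν‖∇u‖₂²⟩`, i.e.
`meanDissipation ν (u(· + s)) = meanDissipation ν u` (`longTimeAvgSup_comp_add_right` for the
nonnegative, locally integrable `t ↦ ν‖∇u(t)‖₂²`, spectral gradient). [folklore] -/
theorem Torus.IsGlobalLerayHopf.meanDissipation_translate (hu : Torus.IsGlobalLerayHopf ν f u₀ u)
    (hν : 0 ≤ ν) {s : ℝ} (hs : 0 ≤ s) :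
    meanDissipation ν (fun t => u (t + s)) = meanDissipation ν u := by
  unfold meanDissipation
  refine longTimeAvgSup_comp_add_right
    (φ := fun t => ν * (FunctionSpaces.Torus.eGradNormSq (u t)).toReal)
    (fun t => mul_nonneg hν ENNReal.toReal_nonneg) hs (fun a b ha hab => ?_)
  refine intervalIntegrable_of_forall_integrableOn_Ioc (fun T hT => ?_) ha hab
  have hLH := hu T hT
  exact ((integrableOn_Ioc_iff_integrableOn_Ioo).mpr (integrable_toReal_of_lintegral_ne_top
    hLH.aemeasurable_eGradNormSq hLH.lintegral_eGradNormSq_lt_top.ne)).const_mul ν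

end LerayHopf

/-! ### Finite-time twins: the running means of a translate against the shifted means

Quantitative versions of the comparison behind `longTimeAvgSup_comp_add_right`, at a FIXED
averaging time `T > 0` (used when a trajectory is restarted at a later instant `s` and one needs
the running means of the restarted trajectory from some explicit `T₀` on, not only their `limsup`):
for `φ ≥ 0`, `timeMean (φ(·+s)) T ≤ ((T+s)/T)·timeMean φ (T+s)`, and if moreover `φ ≤ D` on the
lost prefix `[0, s]`, `timeMean φ (T+s) − s·D/T ≤ timeMean (φ(·+s)) T`. Both are one
`timeMean_comp_add_right` away (Foias–Manley–Rosa–Temam 2001, Ch. II (7.16)–(7.17): restarting at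
a positive time costs an initial layer of length `s`). -/

section FiniteTime

variable {φ : ℝ → ℝ} {s : ℝ}

/-- **Upper shift bound at finite time**: for `φ ≥ 0` locally integrable on `[0, ∞)`, `s ≥ 0`
and `T > 0`, `timeMean (φ(·+s)) T ≤ ((T + s)/T) · timeMean φ (T + s)`
(drop the nonnegative prefix integral `T⁻¹∫₀ˢ φ` in `timeMean_comp_add_right`). [folklore] -/
theorem timeMean_comp_add_right_le (hφ : ∀ t, 0 ≤ φ t)
    (hint : ∀ a b, 0 ≤ a → a ≤ b → IntervalIntegrable φ volume a b) (hs : 0 ≤ s)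
    {T : ℝ} (hT : 0 < T) :
    timeMean (fun t => φ (t + s)) T ≤ (T + s) / T * timeMean φ (T + s) := by
  rw [timeMean_comp_add_right hs hT (hint 0 s le_rfl hs) (hint s (T + s) hs (by linarith))]
  have hI : 0 ≤ ∫ t in (0 : ℝ)..s, φ t := intervalIntegral.integral_nonneg hs fun t _ => hφ t
  have : 0 ≤ T⁻¹ * ∫ t in (0 : ℝ)..s, φ t := mul_nonneg (inv_nonneg.2 hT.le) hI
  linarith

/-- **Lower shift bound at finite time**: for `φ ≥ 0` locally integrable on `[0, ∞)`, `s ≥ 0`,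
`φ ≤ D` on `[0, s]` and `T > 0`, `timeMean φ (T + s) - s·D/T ≤ timeMean (φ(·+s)) T`
(`(T+s)/T ≥ 1` and `∫₀ˢ φ ≤ s·D` in `timeMean_comp_add_right`). [folklore] -/
theorem le_timeMean_comp_add_right (hφ : ∀ t, 0 ≤ φ t)
    (hint : ∀ a b, 0 ≤ a → a ≤ b → IntervalIntegrable φ volume a b) {D : ℝ} (hs : 0 ≤ s)
    (hD : ∀ t ∈ Set.Icc 0 s, φ t ≤ D) {T : ℝ} (hT : 0 < T) :
    timeMean φ (T + s) - s * D / T ≤ timeMean (fun t => φ (t + s)) T := by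
  rw [timeMean_comp_add_right hs hT (hint 0 s le_rfl hs) (hint s (T + s) hs (by linarith))]
  have hI : ∫ t in (0 : ℝ)..s, φ t ≤ s * D := by
    have h := intervalIntegral.integral_mono_on hs (hint 0 s le_rfl hs) intervalIntegrable_const
      (fun t ht => hD t ht)
    simpa using h
  have hTs : 0 < T + s := by linarith
  have hmean : 0 ≤ timeMean φ (T + s) := timeMean_nonneg hφ hTs.le
  have h1 : timeMean φ (T + s) ≤ (T + s) / T * timeMean φ (T + s) := by
    have : 1 ≤ (T + s) / T := by rw [le_div_iff₀ hT]; linarith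
    nlinarith
  have h2 : T⁻¹ * ∫ t in (0 : ℝ)..s, φ t ≤ s * D / T := by
    rw [div_eq_inv_mul]
    exact mul_le_mul_of_nonneg_left hI (inv_nonneg.2 hT.le)
  linarith

end FiniteTime

end Literature.Analysis.FluidPDE

end
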